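import Literature.NumberTheory.EllipticCurves.CasselsTateGeneralCaseKernel
import HarnessLib

/-!
# The Poitou–Tate cochain pairing `Ш²(K, E[m]) × Ш¹(K, E[m]) → ℤ/m²`: INDEPENDENCE OF THE ADMISSIBLE CHOICE
# (two `PTChoice`s of the same `(f, g)` have the same sum of local terms, by Brauer reciprocity)

Route `SemiOrdinaryEisensteinDescent` (BSD, rung W-ALL row 2·3@3), Kolyvagin column, Cassels–Tate lane: print item
`CasselsTateLevelInputsFact` (stmt-BirchSwinnertonDyer-20191; conjunct 1 of `KolyvaginPrimitivesAtThree` stmt-25896; the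
`hCT`/`hCT3` binders of KolyvaginRoadThree, ClassRecordThree, ErratumRoadFive).  After w3 g6's
`CasselsTateConj.casselsTate_levelInputs_of_shaTwoCochain` (p628097) its ONE remaining input for THE canonical invariant maps
is `hPTc` — Milne I Thm. 4.10 (a) for `Ш²(K, E[m])` in the cochain form of `Literature.NumberTheory.EllipticCurves.PTChoice`:
a `2`-cocycle `f` of `E[m]` whose Poitou–Tate pairing `∑_v inv_v [φ_v ∪_desc g_v − h_v]` against every locally trivial
`1`-cocycle `g`, computed by SOME admissible choice `(h; φ_v)`, vanishes, has class `0`.  Width seat `bsd-wall-soed-p2-w3` g7;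
`--supports stmt-BirchSwinnertonDyer-20480`, helper.  Route-free (no `Theses` import).

THIS FILE (step S1 of the Ш²-cochain bridge, see `Cruxes/WildKolyvaginUpperAtThree/SHA2-BRIDGE-w3g7.md`): the value
`∑_v inv_v [φ_v ∪_desc g_v − h_v]` of an admissible choice does NOT depend on the choice when `g` is locally trivial and the
family `inv` satisfies the reciprocity law on `H²(K, μ_{m²})` — so the hypothesis of `hPTc` ("some choice computes `0`") is the
statement "THE Poitou–Tate pairing `⟨[f], [g]⟩` vanishes", and any other admissible choice (e.g. the explicit one of the bridge,
built from cell bsd-schneider's obstruction map `Ψ`) computes the same value.  The cochain identities (Milne, *ADT* I, proof of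
Prop. 6.9, "independent of the choices"; here for the simpler pairing of Thm. 4.10):

* `phi_sub_mem` — two local primitives `φ_v, φ'_v` of `f_v` differ by a `1`-COCYCLE `ζ_v`; `h_sub_mem` — two global
  `2`-cochains `h, h'` with `dh = dh' = f ∪ g` differ by a `2`-COCYCLE `z`;
* `localCocycle_eq` — `φ'_v ∪ g_v − h'_v = (φ_v ∪ g_v − h_v) + ζ_v ∪ g_v − z_v` ON THE NOSE;
* `locClass₂_localCocycle_eq` — on classes `[ζ_v ∪ g_v] = [ζ_v] ∪ [g_v]` (`locClass₂_descCup`) and `[z_v] = loc_v [z]`;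
* `localTerm_eq_sub` — for `g` locally trivial at `v` (`[g_v] = 0`) the local terms differ by `−inv_v (loc_v [z])`;
* **`sum_localTerm_eq`** / **`sum_localTerm_eq_of_subset`** — over any finite `S` carrying both supports the sums agree, by
  `inv.SumInvLocalizationEqZero` applied to `[z]` (for THE maps this predicate is the tree theorem
  `sumInvLocalizationEqZero_canonical_of_numberField`); **`sum_localTerm_eq_zero_iff`** — hence "some admissible choice sums
  to `0`" iff "every admissible choice sums to `0`".

THEOREMS ONLY (no definition, no instance).  Nothing here proves a case of BSD, of Poitou–Tate
or of Cassels–Tate; no named fact is introduced or consumed.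

## References
* [MilneADT2006] J. S. Milne, *Arithmetic Duality Theorems*, 2nd ed. (2006), Ch. I §4 Thm. 4.10 (a); §6, proof of Prop. 6.9
  ("the pairing is independent of the choices made"), proof of Thm. 6.13 (a), p. 88.
* [Harari2020] D. Harari, *Galois Cohomology and Class Field Theory* (2020), Thm. 14.11 (reciprocity), Thm. 17.13.
-/

noncomputable section

open scoped Classical

universe u

-- `Summit.<P>.<Sub>` repeats `BirchSwinnertonDyer` by the tree's layout convention (D-0017)
set_option linter.dupNamespace false
set_option autoImplicit false

namespace Summit.BirchSwinnertonDyer.BirchSwinnertonDyer.Theorems.ShaTwoCochain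

open CategoryTheory _root_.WeierstrassCurve Field Function NumberField
open Literature.NumberTheory.EllipticCurves
open Literature.NumberTheory.GaloisRepresentations Literature.NumberTheory.GaloisCohomology
open Literature.NumberTheory.GaloisRepresentations.DiscreteGaloisModule (mu MuCarrier pairing)
open scoped ContRepresentation

variable {K : Type u} [Field K] [NumberField K] {W : WeierstrassCurve K} {m : ℕ} [NeZero m]
variable {e : geomTorsion W ((m * m : ℕ) : ℤ) → geomTorsion W ((m * m : ℕ) : ℤ) → AlgebraicClosure K}
  {hμ : ∀ S T, e S T ^ (m * m) = 1}
  {hadd₁ : ∀ S₁ S₂ T, e (S₁ + S₂) T = e S₁ T * e S₂ T}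
  {hadd₂ : ∀ S T₁ T₂, e S (T₁ + T₂) = e S T₁ * e S T₂}
  {hgal : ∀ (σ : absoluteGaloisGroup K) (S T : geomTorsion W ((m * m : ℕ) : ℤ)), σ • e S T = e (σ • S) (σ • T)}
variable {f : contTwoCocycles (W.torsionGaloisModule (m : ℤ)).toTopRep}
  {g : contOneCocycles (W.torsionGaloisModule (m : ℤ)).toTopRep}
  (C C₂ : PTChoice W m e hμ hadd₁ hadd₂ hgal f g)

/-! ## The difference cocycles of two admissible choices -/

/-- **Two local primitives of `f_v` differ by a `1`-cocycle**: `ζ_v := φ'_v − φ_v` has `dζ_v = f_v − f_v = 0`. [folklore] -/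
theorem phi_sub_mem (v : Place K) :
    C₂.φ v - C.φ v ∈ contOneCocycles (torsionRepAt W (Place.Completion v) (m : ℤ)) := fun σ τ => by
  have h1 := C.dOne_φ v σ τ
  have h2 := C₂.dOne_φ v σ τ
  rw [h1] at h2
  -- `ρ σ (φ τ) - φ (στ) + φ σ = ρ σ (φ₂ τ) - φ₂ (στ) + φ₂ σ`
  simp only [ContinuousMap.sub_apply, map_sub]
  rw [← sub_eq_zero]
  have h3 : C₂.φ v (σ * τ) - C.φ v (σ * τ) -
      (C₂.φ v σ - C.φ v σ + ((torsionRepAt W (Place.Completion v) (m : ℤ)).ρ σ (C₂.φ v τ) -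
        (torsionRepAt W (Place.Completion v) (m : ℤ)).ρ σ (C.φ v τ))) =
      ((torsionRepAt W (Place.Completion v) (m : ℤ)).ρ σ (C.φ v τ) - C.φ v (σ * τ) + C.φ v σ) -
        ((torsionRepAt W (Place.Completion v) (m : ℤ)).ρ σ (C₂.φ v τ) - C₂.φ v (σ * τ) + C₂.φ v σ) := by
    abel
  rw [h3, h2, sub_self]

/-- **Two global `2`-cochains with `dh = dh' = f ∪_desc g` differ by a `2`-cocycle** `z := h' − h`. [folklore] -/
theorem h_sub_mem : C₂.h - C.h ∈ contTwoCocycles (mu K (m * m)).toTopRep :=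
  (mem_contTwoCocycles_iff_dTwo _ _).2 fun σ τ υ => by
    rw [dTwo_sub, ← C.dTwo_h, ← C₂.dTwo_h, sub_self]

/-! ## The local cocycles of two choices: `φ'_v ∪ g_v − h'_v = (φ_v ∪ g_v − h_v) + ζ_v ∪ g_v − z_v` -/

/-- **ON THE NOSE**: the local `2`-cocycle of the second choice is that of the first plus `ζ_v ∪_desc g_v` minus the
restriction of `z` (`ContinuousH3`: "adding a `1`-cocycle to `α` adds its cup product; adding a `2`-cocycle to `ε` subtracts
it"). [cite: MilneADT2006, Ch. I §6, proof of Prop. 6.9] -/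
theorem localCocycle_eq (v : Place K) :
    C₂.localCocycle v =
      C.localCocycle v + descCup W m (Place.Completion v) e hμ hadd₁ hadd₂ hgal (⟨C₂.φ v - C.φ v, phi_sub_mem C C₂ v⟩ : contOneCocycles (torsionRepAt W (Place.Completion v) (m : ℤ)))
          (resOne (W.torsionGaloisModule (m : ℤ)) (Place.Completion v) g) -
        resTwo (mu K (m * m)) (Place.Completion v) (⟨C₂.h - C.h, h_sub_mem C C₂⟩ : contTwoCocycles (mu K (m * m)).toTopRep) := by
  apply Subtype.ext
  ext p
  obtain ⟨σ, τ⟩ := p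
  simp only [Submodule.coe_add, Submodule.coe_sub, ContinuousMap.add_apply, ContinuousMap.sub_apply]
  rw [PTChoice.localCocycle, PTChoice.localCocycle, ContPairing.cupSubCocycle_apply, ContPairing.cupSubCocycle_apply,
    descCup, ContPairing.cupCocycle_apply_eq_smul, resTwo_apply, resCochain₂_apply, resCochain₂_apply]
  simp only [ContinuousMap.sub_apply, map_sub, LinearMap.sub_apply]
  abel

/-- **On classes**: `[φ'_v ∪ g_v − h'_v] = [φ_v ∪ g_v − h_v] + [ζ_v] ∪_desc [g_v] − loc_v [z]` in `H²(K_v, μ_{m²})`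
(`locClass₂_descCup`: the class of a cup-product cocycle is the cup product of the classes; `locClass₂_resTwo`).
[cite: MilneADT2006, Ch. I §6, proof of Prop. 6.9] -/
theorem locClass₂_localCocycle_eq (v : Place K) :
    locClass₂ (mu K (m * m)) (Place.Completion v) (C₂.localCocycle v) =
      locClass₂ (mu K (m * m)) (Place.Completion v) (C.localCocycle v) +
          descLocalCup W m e hμ hadd₁ hadd₂ hgal (Place.Completion v)
            (locClass _ (Place.Completion v) (⟨C₂.φ v - C.φ v, phi_sub_mem C C₂ v⟩ : contOneCocycles (torsionRepAt W (Place.Completion v) (m : ℤ))))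
            (locClass _ (Place.Completion v) (resOne (W.torsionGaloisModule (m : ℤ)) (Place.Completion v) g)) -
        galoisCohomology.res (mu K (m * m)) (Place.Completion v) 2 (twoCocycleClass _ (⟨C₂.h - C.h, h_sub_mem C C₂⟩ : contTwoCocycles (mu K (m * m)).toTopRep)) := by
  rw [localCocycle_eq C C₂ v, locClass₂_sub, locClass₂_add, locClass₂_descCup, locClass₂_resTwo]

/-! ## The local terms against a locally trivial `g`, and the sums -/

variable (inv : LocalInvariants K (m * m))

/-- **For `g` locally trivial at `v` the local terms of two admissible choices differ by `−inv_v (loc_v [z])`**: the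
cup-product summand `[ζ_v] ∪ [g_v]` vanishes because `[g_v] = 0`. [cite: MilneADT2006, Ch. I §4 Thm. 4.10, §6 proof of Prop. 6.9] -/
theorem localTerm_eq_sub (v : Place K)
    (hg : locClass (W.torsionGaloisModule (m : ℤ)) (Place.Completion v)
      (resOne (W.torsionGaloisModule (m : ℤ)) (Place.Completion v) g) = 0) :
    C₂.localTerm inv v =
      C.localTerm inv v - inv v (galoisCohomology.localization (mu K (m * m)) v 2 (twoCocycleClass _ (⟨C₂.h - C.h, h_sub_mem C C₂⟩ : contTwoCocycles (mu K (m * m)).toTopRep))) := by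
  have hlr : inv v (galoisCohomology.res (mu K (m * m)) (Place.Completion v) 2 (twoCocycleClass _ (⟨C₂.h - C.h, h_sub_mem C C₂⟩ : contTwoCocycles (mu K (m * m)).toTopRep))) =
      inv v (galoisCohomology.localization (mu K (m * m)) v 2 (twoCocycleClass _ (⟨C₂.h - C.h, h_sub_mem C C₂⟩ : contTwoCocycles (mu K (m * m)).toTopRep))) := rfl
  rw [← hlr, PTChoice.localTerm, PTChoice.localTerm, locClass₂_localCocycle_eq C C₂ v, hg, map_zero, add_zero]
  exact map_sub (inv v) _ _

/-- Where both local terms vanish, so does `inv_v (loc_v [z])`. [folklore] -/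
theorem inv_localization_hDiff_eq_zero (v : Place K)
    (hg : locClass (W.torsionGaloisModule (m : ℤ)) (Place.Completion v)
      (resOne (W.torsionGaloisModule (m : ℤ)) (Place.Completion v) g) = 0)
    (h₁ : C.localTerm inv v = 0) (h₂ : C₂.localTerm inv v = 0) :
    inv v (galoisCohomology.localization (mu K (m * m)) v 2 (twoCocycleClass _ (⟨C₂.h - C.h, h_sub_mem C C₂⟩ : contTwoCocycles (mu K (m * m)).toTopRep))) = 0 := by
  have h := localTerm_eq_sub C C₂ inv v hg
  rw [h₁, h₂, zero_sub, eq_comm, neg_eq_zero] at h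
  exact h

-- `hPT'` is NOT a named fact: it is the reciprocity PREDICATE `LocalInvariants.SumInvLocalizationEqZero` on the chosen family
-- `inv` (for THE canonical maps, the tree theorem `sumInvLocalizationEqZero_canonical_of_numberField`).
/-- **INDEPENDENCE OF THE ADMISSIBLE CHOICE.**  Let `g` be locally trivial at every place and let the family `inv` satisfy the
reciprocity law on `H²(K, μ_{m²})`.  If `S` is a finite set of places outside which the local terms of BOTH admissible choices
`C, C'` for `(f, g)` vanish, then `∑_{v ∈ S} t_v(C') = ∑_{v ∈ S} t_v(C)`: the terms differ by `−inv_v (loc_v [z])` for the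
GLOBAL `2`-cocycle `z = h' − h`, these vanish off `S`, and `∑_{v ∈ S} inv_v (loc_v [z]) = 0` by reciprocity.  This is the
well-definedness of the Poitou–Tate pairing `Ш²(K, E[m]) × Ш¹(K, E[m]) → ℤ/m²` on cochain representatives.
[cite: MilneADT2006, Ch. I §4 Thm. 4.10 (a); §6, proof of Prop. 6.9] [cite: Harari2020, Thm. 14.11] -/
theorem sum_localTerm_eq (hPT' : inv.SumInvLocalizationEqZero)
    (hg : ∀ v : Place K, locClass (W.torsionGaloisModule (m : ℤ)) (Place.Completion v)
      (resOne (W.torsionGaloisModule (m : ℤ)) (Place.Completion v) g) = 0)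
    {S : Finset (Place K)} (hS : ∀ v ∉ S, C.localTerm inv v = 0) (hS₂ : ∀ v ∉ S, C₂.localTerm inv v = 0) :
    ∑ v ∈ S, C₂.localTerm inv v = ∑ v ∈ S, C.localTerm inv v := by
  have hc : ∀ v ∉ S, inv v (galoisCohomology.localization (mu K (m * m)) v 2 (twoCocycleClass _ (⟨C₂.h - C.h, h_sub_mem C C₂⟩ : contTwoCocycles (mu K (m * m)).toTopRep))) = 0 :=
    fun v hv => inv_localization_hDiff_eq_zero C C₂ inv v (hg v) (hS v hv) (hS₂ v hv)
  calc ∑ v ∈ S, C₂.localTerm inv v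
      = ∑ v ∈ S, (C.localTerm inv v -
          inv v (galoisCohomology.localization (mu K (m * m)) v 2 (twoCocycleClass _ (⟨C₂.h - C.h, h_sub_mem C C₂⟩ : contTwoCocycles (mu K (m * m)).toTopRep)))) :=
        Finset.sum_congr rfl fun v _ => localTerm_eq_sub C C₂ inv v (hg v)
    _ = ∑ v ∈ S, C.localTerm inv v := by
        rw [Finset.sum_sub_distrib, hPT' (twoCocycleClass _ (⟨C₂.h - C.h, h_sub_mem C C₂⟩ : contTwoCocycles (mu K (m * m)).toTopRep)) S hc, sub_zero]

/-- **The same with two supports**: if the local terms of `C` vanish off `S` and those of `C'` off `S'`, then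
`∑_{v ∈ S'} t_v(C') = ∑_{v ∈ S} t_v(C)` (both are the sum over `S ∪ S'`). [cite: MilneADT2006, Ch. I §4 Thm. 4.10 (a)] -/
theorem sum_localTerm_eq_of_subset (hPT' : inv.SumInvLocalizationEqZero)
    (hg : ∀ v : Place K, locClass (W.torsionGaloisModule (m : ℤ)) (Place.Completion v)
      (resOne (W.torsionGaloisModule (m : ℤ)) (Place.Completion v) g) = 0)
    {S S₂ : Finset (Place K)} (hS : ∀ v ∉ S, C.localTerm inv v = 0) (hS₂ : ∀ v ∉ S₂, C₂.localTerm inv v = 0) :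
    ∑ v ∈ S₂, C₂.localTerm inv v = ∑ v ∈ S, C.localTerm inv v := by
  have h1 : ∑ v ∈ S, C.localTerm inv v = ∑ v ∈ S ∪ S₂, C.localTerm inv v :=
    Finset.sum_subset Finset.subset_union_left fun v _ hv => hS v hv
  have h2 : ∑ v ∈ S₂, C₂.localTerm inv v = ∑ v ∈ S ∪ S₂, C₂.localTerm inv v :=
    Finset.sum_subset Finset.subset_union_right fun v _ hv => hS₂ v hv
  rw [h1, h2]
  exact sum_localTerm_eq C C₂ inv hPT' hg
    (fun v hv => hS v fun h => hv (Finset.mem_union_left _ h))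
    (fun v hv => hS₂ v fun h => hv (Finset.mem_union_right _ h))

/-- **"Some admissible choice sums to `0`" iff "every admissible choice sums to `0`"** (for `g` locally trivial, `inv`
satisfying reciprocity): the hypothesis of `hPTc` in `CasselsTateConj.casselsTate_levelInputs_of_shaTwoCochain` is a statement
about THE Poitou–Tate pairing `⟨[f], [g]⟩`, not about the choice. [cite: MilneADT2006, Ch. I §4 Thm. 4.10 (a); §6 proof of Thm. 6.13 (a), p. 88] -/
theorem sum_localTerm_eq_zero_iff (hPT' : inv.SumInvLocalizationEqZero)
    (hg : ∀ v : Place K, locClass (W.torsionGaloisModule (m : ℤ)) (Place.Completion v)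
      (resOne (W.torsionGaloisModule (m : ℤ)) (Place.Completion v) g) = 0)
    {S S₂ : Finset (Place K)} (hS : ∀ v ∉ S, C.localTerm inv v = 0) (hS₂ : ∀ v ∉ S₂, C₂.localTerm inv v = 0) :
    ∑ v ∈ S₂, C₂.localTerm inv v = 0 ↔ ∑ v ∈ S, C.localTerm inv v = 0 := by
  rw [sum_localTerm_eq_of_subset C C₂ inv hPT' hg hS hS₂]

/-- **Consequence for `hPTc`'s hypothesis shape**: if for a locally trivial `g` SOME admissible choice with finite support
sums to a NON-ZERO value, then NO admissible choice with finite support sums to `0` — so a `2`-cocycle `f` admitting, against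
some locally trivial `g`, an admissible choice with non-zero Poitou–Tate value violates the hypothesis of `hPTc` (this is how
the bridge's explicit choice will be played against the hypothesis). [cite: MilneADT2006, Ch. I §4 Thm. 4.10 (a)] -/
theorem not_exists_sum_eq_zero_of_sum_ne_zero (hPT' : inv.SumInvLocalizationEqZero)
    (hg : ∀ v : Place K, locClass (W.torsionGaloisModule (m : ℤ)) (Place.Completion v)
      (resOne (W.torsionGaloisModule (m : ℤ)) (Place.Completion v) g) = 0)
    {S : Finset (Place K)} (hS : ∀ v ∉ S, C.localTerm inv v = 0) (hne : ∑ v ∈ S, C.localTerm inv v ≠ 0) :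
    ¬ ∃ (C' : PTChoice W m e hμ hadd₁ hadd₂ hgal f g) (S' : Finset (Place K)),
      (∀ v ∉ S', C'.localTerm inv v = 0) ∧ ∑ v ∈ S', C'.localTerm inv v = 0 := by
  rintro ⟨C', S', hS', h0⟩
  exact hne ((sum_localTerm_eq_zero_iff C C' inv hPT' hg hS hS').1 h0)

end Summit.BirchSwinnertonDyer.BirchSwinnertonDyer.Theorems.ShaTwoCochain

end
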